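import Mathlib
import HarnessLib
import Summits.NavierStokesRegularity.NavierStokesRegularity.Theorems.LocalSineTubeDoorLocalPointZoomDiag
import Summits.NavierStokesRegularity.NavierStokesRegularity.Theorems.LocalSineTubeDoorLocalPointZoomGradSlices
import Summits.NavierStokesRegularity.NavierStokesRegularity.Theorems.LocalVelCompTubeDoorLocalPointZoomVelSlices
import Summits.NavierStokesRegularity.NavierStokesRegularity.Theorems.LocalSineTubeDoorLocalPointZoomGrad
import Summits.NavierStokesRegularity.NavierStokesRegularity.Theorems.LocalSineTubeDoorLocalPointZoomCurl
import Summits.NavierStokesRegularity.NavierStokesRegularity.Theorems.LocalIrrotationalScarDoorZoomFrameSuitable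
import Summits.NavierStokesRegularity.NavierStokesRegularity.Theorems.LocalIrrotationalScarDoorZoomApex
import Summits.NavierStokesRegularity.NavierStokesRegularity.Theorems.LocalIrrotationalScarDoorZoomTopFading

/-!
# STAGED door S15 `LocalIrrotationalScarDoor` (nsreg-p1 ROUND-14) — THE ZOOM CRUX `K1Rep`
# (`LocalPointZoomScarCurlRep`) AS A TREE THEOREM

`localPointZoomScarCurlRep` — the text of the route item `LocalPointZoomScarCurlRep` of the STAGED door
(`HOME/ns-regularity-ideate-p1/route-irrotscar/`, gate render `bc/rendered-LocalIrrotationalScarDoor.lean` l. 95,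
ROUND-14 (2) «representative pair») proved VERBATIM as a self-standing statement: at a point `(x₀, T)` where a classical
Leray–Hopf flow from rapidly decaying data obeys the LOCAL SPACE–TIME Type-I bound
`‖u(t,x)‖ (‖x − x₀‖ + √(ν(T−t))) ≤ M`, has a pointwise final-time velocity trace on the side `x₀ + S` (`S` open,
dilation-invariant, `0 ∉ S`) with `u(T,·) ∈ C¹` and `curl u(T,·) = 0` there, and is NOT backward bounded, there is a
zoom limit `(w, π, H)` — suitable weak on the backward slab, `𝐈 < ⊤`, APEX bound a.e., backward-singular origin — with
a continuous representative `Uc` on `]-1,0[ × S` whose CURL FADES AT THE TOP locally uniformly on `S`.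

Proof: the frame with suitable data (`…ZoomFrameSuitable`), the apex transfer (`…ZoomApex`), the slice convergence of
the zooms (p6 g5/g6 chain `localZoomFrame_diag`, diagonal form), `Uc := v₁` (the profile representative), and the
top-curl fading = the linear rate `‖curl Zⱼ(s)‖ ≤ K′(−s)` of the zooms on the side (`…ZoomTopFading.zoom_top_curl_rate`:
uniform `C³` bounds from `NSBoundedHigherRegularityBounds_holds`, the vorticity equation, and the final-time trace)
passed to the limit along the pointwise vorticity convergence.

At the birth of the route, the item closes by `theorem … : Theses.LocalIrrotationalScarDoor.LocalPointZoomScarCurlRep :=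
localPointZoomScarCurlRep` (the texts agree token for token).  Together with the landed residue
`…RellichScarApexLocalisationIrrotHalfspaceLiouville.not_isBackwardSingularPoint_of_topCurlVanishing_halfspace` (K2Rep)
and p1's 15-line `closes`, the door S15 is then a theorem: a space–time Type-I blow-up point is never a boundary point of a
final-time `C¹`-irrotational dilation-invariant side.

Seat nsreg-p6 g7 (anchor `--supports stmt-NavierStokesRegularity-11719` until the route is born).
WHAT THIS IS NOT: not NS regularity (a conditional door statement about Type-I scenarios); not a route open.
-/

noncomputable section

open MeasureTheory Set Function Filter Topology TopologicalSpace Metric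
open Literature.Analysis Literature.Analysis.FluidPDE Literature.Analysis.FluidPDE.SereginSverak2009
open Summit.NavierStokesRegularity.NavierStokesRegularity.Theorems
open Summit.NavierStokesRegularity.NavierStokesRegularity.Theorems.LocalSineTubeDoorLocalPointZoomCurl
open Summit.NavierStokesRegularity.NavierStokesRegularity.Theorems.LocalSineTubeDoorLocalPointZoomSlices
open Summit.NavierStokesRegularity.NavierStokesRegularity.Theorems.LocalVelCompTubeDoorLocalPointZoomVel
open Summit.NavierStokesRegularity.NavierStokesRegularity.Theorems.LocalSineTubeDoorLocalPointZoomGrad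
open Summit.NavierStokesRegularity.NavierStokesRegularity.Theorems.LocalSineTubeDoorLocalPointZoomDiag
open Summit.NavierStokesRegularity.NavierStokesRegularity.Theorems.LocalSineTubeDoorLocalPointZoomGradSlices
open Summit.NavierStokesRegularity.NavierStokesRegularity.Theorems.LocalIrrotationalScarDoorZoomFrameSuitable
open Summit.NavierStokesRegularity.NavierStokesRegularity.Theorems.LocalIrrotationalScarDoorZoomApex
open Summit.NavierStokesRegularity.NavierStokesRegularity.Theorems.LocalIrrotationalScarDoorZoomTopFading
open scoped NNReal ENNReal

-- the summit and its single sub-problem share the name (CONVENTIONS §1), as in every Theorems file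
set_option linter.dupNamespace false

namespace Summit.NavierStokesRegularity.NavierStokesRegularity.Theorems.LocalIrrotationalScarDoorLocalPointZoomScarCurlRep

set_option maxHeartbeats 800000 in
/-- **K1Rep — the local point zoom with an irrotational final-time side trace** (text of the route item
`Theses.LocalIrrotationalScarDoor.LocalPointZoomScarCurlRep`, verbatim). -/
theorem localPointZoomScarCurlRep :
    ∀ (ν T : ℝ), 0 < ν → 0 < T → ∀ (u : ℝ → EuclideanSpace ℝ (Fin 3) → EuclideanSpace ℝ (Fin 3))
      (p : ℝ → EuclideanSpace ℝ (Fin 3) → ℝ),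
    Literature.Analysis.FluidPDE.IsClassicalNSSolutionOn (Set.Ico 0 T) ν 0 u p →
    Literature.Analysis.FluidPDE.IsLerayHopfOn T ν 0 (u 0) u →
    Literature.Analysis.FluidPDE.HasRapidSpatialDecay (u 0) →
    ∀ (x₀ : EuclideanSpace ℝ (Fin 3)) (S : Set (EuclideanSpace ℝ (Fin 3))) (ρ M : ℝ), IsOpen S →
    (∀ y ∈ S, ∀ c : ℝ, 0 < c → c • y ∈ S) → (0 : EuclideanSpace ℝ (Fin 3)) ∉ S → 0 < ρ →
    (∀ t ∈ Set.Ico 0 T, T - ρ ^ 2 < t → ∀ x ∈ Metric.ball x₀ ρ,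
      ‖u t x‖ * (‖x - x₀‖ + Real.sqrt (ν * (T - t))) ≤ M) →
    (∀ x ∈ Metric.ball x₀ ρ, x - x₀ ∈ S →
      Filter.Tendsto (fun t => u t x) (nhdsWithin T (Set.Iio T)) (nhds (u T x))) →
    ContDiffOn ℝ 1 (u T) (Metric.ball x₀ ρ ∩ {x | x - x₀ ∈ S}) →
    (∀ x ∈ Metric.ball x₀ ρ, x - x₀ ∈ S → Literature.Analysis.FluidPDE.curl (u T) x = 0) →
    ¬ Literature.Analysis.FluidPDE.IsBackwardBoundedAt u T x₀ →
    ∃ (C : ℝ) (w : ℝ → EuclideanSpace ℝ (Fin 3) → EuclideanSpace ℝ (Fin 3))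
      (π : ℝ → EuclideanSpace ℝ (Fin 3) → ℝ)
      (H : ℝ → EuclideanSpace ℝ (Fin 3) → EuclideanSpace ℝ (Fin 3) →L[ℝ] EuclideanSpace ℝ (Fin 3))
      (Uc : ℝ → EuclideanSpace ℝ (Fin 3) → EuclideanSpace ℝ (Fin 3)),
      Literature.Analysis.FluidPDE.IsSuitableWeakSolutionOn
        (Literature.Analysis.FluidPDE.slab (EuclideanSpace ℝ (Fin 3)) (Set.Iio (0 : ℝ)) isOpen_Iio) 1 0 w π ∧
      Literature.Analysis.FluidPDE.HasWeakSpatialGradientOn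
        (Literature.Analysis.FluidPDE.slab (EuclideanSpace ℝ (Fin 3)) (Set.Iio (0 : ℝ)) isOpen_Iio) w H ∧
      Literature.Analysis.FluidPDE.typeIBound (Set.Iio (0 : ℝ) ×ˢ Set.univ) w π H < ⊤ ∧
      (∀ᵐ z ∂(MeasureTheory.volume.restrict (Set.Iio (0 : ℝ) ×ˢ (Set.univ : Set (EuclideanSpace ℝ (Fin 3))))),
        ‖w z.1 z.2‖ ≤ C / (‖z.2‖ + Real.sqrt (-z.1))) ∧
      Literature.Analysis.FluidPDE.IsBackwardSingularPoint w 0 ∧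
      Function.uncurry Uc =ᵐ[MeasureTheory.volume.restrict (Set.Ioo (-1 : ℝ) 0 ×ˢ S)] Function.uncurry w ∧
      ContinuousOn (Function.uncurry Uc) (Set.Ioo (-1 : ℝ) 0 ×ˢ S) ∧
      ∀ x₁ ∈ S, ∀ θ : ℝ, 0 < θ → ∃ s₀ δ : ℝ, s₀ < 0 ∧ (-1 : ℝ) ≤ s₀ ∧ 0 < δ ∧
        ∀ s ∈ Set.Ioo s₀ 0, ∀ x ∈ Metric.ball x₁ δ, ‖Literature.Analysis.FluidPDE.curl (Uc s) x‖ ≤ θ := by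
  intro ν T hν hT u p hsol hLH _ x₀ S ρ M hS hSdil h0S hρ hM' htrace hC1 hcurl0 hnotbd
  -- the space–time bound implies the time-only bound of the frame
  have hM : ∀ t ∈ Ico 0 T, T - ρ ^ 2 < t → ∀ x ∈ ball x₀ ρ, ‖u t x‖ * Real.sqrt (ν * (T - t)) ≤ M := by
    intro t ht hρt x hx
    have h := hM' t ht hρt x hx
    have h0 : 0 ≤ ‖u t x‖ * ‖x - x₀‖ := mul_nonneg (norm_nonneg _) (norm_nonneg _)
    nlinarith [h, h0]
  obtain ⟨R, C₁, v', π', lam, w, v₁, ϖ, H, Ks, r₁, hR, hlam, hlam0, hball1, hr₁, hr₁1, hKs, hL3,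
    ⟨hsww, hH, h4top, hsingw, hvm, hwm⟩, hae, hP, hsing₁, hpt⟩ :=
    localTreeZoomFrame_suitable hν hT hsol hLH hρ hM hnotbd
  have hμpos : ∀ j, 0 < R * (lam j / 2) := fun j => mul_pos hR (half_pos (hlam j))
  have hμ0 : Tendsto (fun j => R * (lam j / 2)) atTop (𝓝 0) := by simpa using (hlam0.div_const 2).const_mul R
  -- the apex bound of the limit, a.e. on the slab
  have hapex : ∀ᵐ z ∂(volume.restrict (Iio (0 : ℝ) ×ˢ (univ : Set (EuclideanSpace ℝ (Fin 3))))),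
      ‖w z.1 z.2‖ ≤ (M / ν) / (‖z.2‖ + Real.sqrt (-z.1)) :=
    ae_apex_of_zoomLimit (x₀ := x₀) hν hT hρ hM' hμpos hμ0 hpt hvm hwm hL3
  -- ## the slice convergence of velocities / gradients / vorticities along the zooms (as in `…ZoomData`)
  have hconv : ∀ s < 0, ∀ (y : EuclideanSpace ℝ (Fin 3)) (yseq : ℕ → EuclideanSpace ℝ (Fin 3)),
      Tendsto yseq atTop (𝓝 y) →
      Tendsto (fun j => (R * (lam j / 2) / ν) • u (T + (R * (lam j / 2)) ^ 2 * s / ν)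
        (x₀ + (R * (lam j / 2)) • yseq j)) atTop (𝓝 (v₁ s y)) ∧
      Tendsto (fun j => ((R * (lam j / 2)) ^ 2 / ν) •
        fderiv ℝ (u (T + (R * (lam j / 2)) ^ 2 * s / ν)) (x₀ + (R * (lam j / 2)) • yseq j)) atTop
        (𝓝 (fderiv ℝ (v₁ s) y)) ∧
      Tendsto (fun j => ((R * (lam j / 2)) ^ 2 / ν) •
        curl (u (T + (R * (lam j / 2)) ^ 2 * s / ν)) (x₀ + (R * (lam j / 2)) • yseq j)) atTop
        (𝓝 (curl (v₁ s) y)) := by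
    intro s hs y yseq hyseq
    -- ## the scaling factor `σ = √(−s)`
    have hns : 0 < -s := neg_pos.2 hs
    set σ : ℝ := Real.sqrt (-s) with hσdef
    have hσ : 0 < σ := Real.sqrt_pos.2 hns
    have hσ2 : σ ^ 2 = -s := Real.sq_sqrt hns.le
    have hσne : σ ≠ 0 := hσ.ne'
    -- ## the rescaled frame
    set lam' : ℕ → ℝ := fun j => σ * lam j with hlam'def
    have hlam' : ∀ j, 0 < lam' j := fun j => mul_pos hσ (hlam j)
    have hlam0' : Tendsto lam' atTop (𝓝 0) := by
      show Tendsto (fun j => σ * lam j) atTop (𝓝 0)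
      simpa using hlam0.const_mul σ
    set w' : ℝ → (EuclideanSpace ℝ (Fin 3)) → (EuclideanSpace ℝ (Fin 3)) :=
      σ • stPull (σ ^ 2) σ (0 : ℝ) (0 : (EuclideanSpace ℝ (Fin 3))) w with hw'def
    set v₁' : ℝ → (EuclideanSpace ℝ (Fin 3)) → (EuclideanSpace ℝ (Fin 3)) :=
      σ • stPull (σ ^ 2) σ (0 : ℝ) (0 : (EuclideanSpace ℝ (Fin 3))) v₁ with hv₁'def
    have hZZ : ∀ j, (lam' j) • stPull ((lam' j) ^ 2) (lam' j) (0 : ℝ) (0 : (EuclideanSpace ℝ (Fin 3))) v' =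
        σ • stPull (σ ^ 2) σ (0 : ℝ) (0 : (EuclideanSpace ℝ (Fin 3)))
          ((lam j) • stPull ((lam j) ^ 2) (lam j) (0 : ℝ) (0 : (EuclideanSpace ℝ (Fin 3))) v') := by
      intro j
      simp only [hlam'def]
      rw [zoom_zoom]
    -- (pt') identification with the zooms of `u` at the scales `R σλⱼ/2`
    have hpt' : ∀ (j : ℕ) (s' : ℝ) (y' : (EuclideanSpace ℝ (Fin 3))),
        ((lam' j) • stPull ((lam' j) ^ 2) (lam' j) (0 : ℝ) (0 : (EuclideanSpace ℝ (Fin 3))) v') s' y' =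
          ((R * (lam' j / 2)) / ν) • u (T + (R * (lam' j / 2)) ^ 2 * s' / ν) (x₀ + (R * (lam' j / 2)) • y') := by
      intro j s' y'
      have h := hpt j (σ ^ 2 * s') (σ • y')
      simp only [smul_stPull_apply, zero_add] at h ⊢
      simp only [hlam'def]
      rw [show (σ * lam j) ^ 2 * s' = lam j ^ 2 * (σ ^ 2 * s') by ring,
        show (σ * lam j) • y' = lam j • σ • y' by rw [smul_smul, mul_comm],
        mul_smul, h, smul_smul, smul_smul,
        show σ * (R * (lam j / 2) / ν) = R * (σ * lam j / 2) / ν by ring,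
        show T + (R * (lam j / 2)) ^ 2 * (σ ^ 2 * s') / ν = T + (R * (σ * lam j / 2)) ^ 2 * s' / ν by ring,
        show R * (lam j / 2) * σ = R * (σ * lam j / 2) by ring]
    -- (L3') local `L³` convergence of the rescaled zooms to `w'`
    have hus : ∀ f g : ℝ → (EuclideanSpace ℝ (Fin 3)) → (EuclideanSpace ℝ (Fin 3)),
        uncurry (f - g) = uncurry f - uncurry g := fun f g => rfl
    have hL3' : ∀ a : ℝ, 0 < a → Tendsto (fun j => eLpNorm
        (uncurry ((lam' j) • stPull ((lam' j) ^ 2) (lam' j) (0 : ℝ) (0 : (EuclideanSpace ℝ (Fin 3))) v') - uncurry w') 3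
        (volume.restrict (parabolicCylinder a (0 : ℝ × (EuclideanSpace ℝ (Fin 3)))))) atTop (𝓝 0) := by
      intro a ha
      have hdiff : ∀ j, uncurry ((lam' j) • stPull ((lam' j) ^ 2) (lam' j) (0 : ℝ) (0 : (EuclideanSpace ℝ (Fin 3))) v') -
          uncurry w' = uncurry (σ • stPull (σ ^ 2) σ (0 : ℝ) (0 : (EuclideanSpace ℝ (Fin 3)))
            ((lam j) • stPull ((lam j) ^ 2) (lam j) (0 : ℝ) (0 : (EuclideanSpace ℝ (Fin 3))) v' - w)) := by
        intro j
        rw [hZZ j]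
        funext z
        obtain ⟨s', y'⟩ := z
        simp only [hw'def, uncurry_apply_pair, Pi.sub_apply, smul_stPull_apply, smul_sub]
      have hconst : (‖σ‖ₑ * (ENNReal.ofReal ((σ ^ 2 * σ ^ 3)⁻¹)) ^ (1 / (3 : ℝ≥0∞).toReal)) ≠ ⊤ :=
        ENNReal.mul_ne_top enorm_ne_top
          (ENNReal.rpow_ne_top_of_nonneg (one_div_nonneg.2 ENNReal.toReal_nonneg) ENNReal.ofReal_ne_top)
      have key := ENNReal.Tendsto.const_mul (hL3 (a * σ) (mul_pos ha hσ)) (Or.inr hconst)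
      rw [mul_zero] at key
      refine key.congr fun j => ?_
      rw [hdiff j]
      conv_rhs => rw [show a = a * σ / σ by field_simp]
      rw [eLpNorm_uncurry_zoom hσ σ _ (a * σ) three_ne_zero ENNReal.ofNat_ne_top, hus]
    -- (ae') the rescaled limit agrees a.e. with the rescaled profile
    have hslab : stAffine (σ ^ 2) σ (0 : ℝ) (0 : (EuclideanSpace ℝ (Fin 3))) ⁻¹'
        (Iio (0 : ℝ) ×ˢ (univ : Set (EuclideanSpace ℝ (Fin 3)))) =
        Iio (0 : ℝ) ×ˢ (univ : Set (EuclideanSpace ℝ (Fin 3))) := by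
      ext z
      simp only [mem_preimage, mem_prod, mem_Iio, mem_univ, and_true, stAffine_fst, zero_add]
      exact ⟨fun h => neg_of_mul_neg_right h (pow_pos hσ 2).le,
        fun h => mul_neg_of_pos_of_neg (pow_pos hσ 2) h⟩
    have hae' : ∀ᵐ x ∂(volume.restrict (Iio (0 : ℝ) ×ˢ (univ : Set (EuclideanSpace ℝ (Fin 3))))),
        uncurry w' x = uncurry v₁' x := by
      have h := ae_eq_restrict_comp_stAffine (f := uncurry w) (g := uncurry v₁) (pow_pos hσ 2) hσ
        (0 : ℝ) (0 : (EuclideanSpace ℝ (Fin 3))) hae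
      rw [hslab] at h
      filter_upwards [h] with z hz
      show σ • uncurry w (stAffine (σ ^ 2) σ (0 : ℝ) (0 : (EuclideanSpace ℝ (Fin 3))) z) =
        σ • uncurry v₁ (stAffine (σ ^ 2) σ (0 : ℝ) (0 : (EuclideanSpace ℝ (Fin 3))) z)
      rw [show uncurry w (stAffine (σ ^ 2) σ (0 : ℝ) (0 : (EuclideanSpace ℝ (Fin 3))) z) =
        uncurry v₁ (stAffine (σ ^ 2) σ (0 : ℝ) (0 : (EuclideanSpace ℝ (Fin 3))) z) from hz]
    -- (P') the rescaled profile is in the class (scaling invariance of rate / continuity / mildness)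
    have hrate' : HasTypeITimeDecay C₁ v₁' := rate_smul_stPull hP.1 hσ
    have hcont' : ContinuousOn (uncurry v₁') (Iio (0 : ℝ) ×ˢ univ) := cont_smul_stPull hP.2.1 hσ
    have hmild' := mild_smul_stPull hP.2.2.1 hσ
    -- ## common bookkeeping: the time and the scale at slice `s`
    have e2 : ∀ j, T + (R * (σ * lam j / 2)) ^ 2 * (-1) / ν = T + (R * (lam j / 2)) ^ 2 * s / ν := by
      intro j
      have hs' : s = -σ ^ 2 := by rw [hσ2]; ring
      rw [hs']; ring
    have e3 : ∀ j, R * (σ * lam j / 2) * σ⁻¹ = R * (lam j / 2) := by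
      intro j
      calc R * (σ * lam j / 2) * σ⁻¹ = R * (lam j / 2) * (σ * σ⁻¹) := by ring
        _ = R * (lam j / 2) := by rw [mul_inv_cancel₀ hσne, mul_one]
    have hvel : Tendsto (fun j => (R * (lam j / 2) / ν) • u (T + (R * (lam j / 2)) ^ 2 * s / ν)
        (x₀ + (R * (lam j / 2)) • yseq j)) atTop (𝓝 (v₁ s y)) := by
      -- ## (i) VELOCITIES: the velocity upgrade at time `−1` of the rescaled frame
      have hyseq' : Tendsto (fun j => σ⁻¹ • yseq j) atTop (𝓝 (σ⁻¹ • y)) := hyseq.const_smul σ⁻¹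
      have key := (localZoomFrame_diag hν hT hsol.smooth_velocity.continuousOn hρ hM hR hball1 hlam'
        hlam0' hr₁ hr₁1 hKs hpt' hL3' hae' hrate' hcont' hmild' (σ⁻¹ • y) tendsto_const_nhds hyseq').1
      have hZ : ∀ j, ((lam' j) • stPull ((lam' j) ^ 2) (lam' j) (0 : ℝ) (0 : (EuclideanSpace ℝ (Fin 3))) v') (-1)
          (σ⁻¹ • yseq j) = σ • (((R * (lam j / 2)) / ν) • u (T + (R * (lam j / 2)) ^ 2 * s / ν)
            (x₀ + (R * (lam j / 2)) • yseq j)) := by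
        intro j
        rw [hpt' j (-1) (σ⁻¹ • yseq j)]
        simp only [hlam'def, smul_smul]
        have e4 : R * (σ * lam j / 2) / ν = σ * (R * (lam j / 2) / ν) := by ring
        rw [e2 j, e3 j, e4]
      have hlimit : v₁' (-1) (σ⁻¹ • y) = σ • v₁ s y := by
        simp only [hv₁'def, smul_stPull_apply, smul_smul, mul_inv_cancel₀ hσne, one_smul, zero_add]
        rw [show σ ^ 2 * (-1) = s by rw [hσ2]; ring]
      have key' : Tendsto (fun j => σ • (((R * (lam j / 2)) / ν) •
          u (T + (R * (lam j / 2)) ^ 2 * s / ν) (x₀ + (R * (lam j / 2)) • yseq j))) atTop (𝓝 (σ • v₁ s y)) := by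
        rw [← hlimit]
        exact Tendsto.congr hZ key
      have key3 := key'.const_smul σ⁻¹
      simp only [smul_smul, inv_mul_cancel_left₀ hσne, inv_mul_cancel₀ hσne, one_smul] at key3
      exact key3
    have hgrad : Tendsto (fun j => ((R * (lam j / 2)) ^ 2 / ν) •
        fderiv ℝ (u (T + (R * (lam j / 2)) ^ 2 * s / ν)) (x₀ + (R * (lam j / 2)) • yseq j)) atTop
        (𝓝 (fderiv ℝ (v₁ s) y)) := by
      -- ## (ii) GRADIENTS: the gradient upgrade at time `−1` of the rescaled frame
      have hyseq' : Tendsto (fun j => σ⁻¹ • yseq j) atTop (𝓝 (σ⁻¹ • y)) := hyseq.const_smul σ⁻¹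
      have key := (localZoomFrame_diag hν hT hsol.smooth_velocity.continuousOn hρ hM hR hball1 hlam'
        hlam0' hr₁ hr₁1 hKs hpt' hL3' hae' hrate' hcont' hmild' (σ⁻¹ • y) tendsto_const_nhds hyseq').2
      have hgradZ : ∀ j, fderiv ℝ (((lam' j) • stPull ((lam' j) ^ 2) (lam' j) (0 : ℝ) (0 : (EuclideanSpace ℝ (Fin 3))) v') (-1))
          (σ⁻¹ • yseq j) = (-s) • (((R * (lam j / 2)) ^ 2 / ν) •
            fderiv ℝ (u (T + (R * (lam j / 2)) ^ 2 * s / ν)) (x₀ + (R * (lam j / 2)) • yseq j)) := by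
        intro j
        have hfun : ((lam' j) • stPull ((lam' j) ^ 2) (lam' j) (0 : ℝ) (0 : (EuclideanSpace ℝ (Fin 3))) v') (-1) =
            (((R * (lam' j / 2)) / ν) • stPull ((R * (lam' j / 2)) ^ 2 / ν) (R * (lam' j / 2)) T x₀ u)
              (-1) := by
          funext y'
          rw [hpt' j (-1) y', smul_stPull_apply]
          congr 2
          ring
        have e1 : R * (σ * lam j / 2) / ν * (R * (σ * lam j / 2)) = (-s) * ((R * (lam j / 2)) ^ 2 / ν) := by
          rw [← hσ2]; ring
        rw [hfun, fderiv_smul_stPull]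
        simp only [hlam'def, smul_smul]
        rw [e1, show T + (R * (σ * lam j / 2)) ^ 2 / ν * (-1) = T + (R * (lam j / 2)) ^ 2 * s / ν by
          rw [← e2 j]; ring, e3 j]
      have hlimit : fderiv ℝ (v₁' (-1)) (σ⁻¹ • y) = (-s) • fderiv ℝ (v₁ s) y := by
        simp only [hv₁'def]
        rw [fderiv_smul_stPull]
        simp only [smul_smul, mul_inv_cancel₀ hσne, one_smul, zero_add]
        rw [show σ ^ 2 * (-1) = s by rw [hσ2]; ring, show σ * σ = -s by rw [← hσ2]; ring]
      have key' : Tendsto (fun j => (-s) • (((R * (lam j / 2)) ^ 2 / ν) •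
          fderiv ℝ (u (T + (R * (lam j / 2)) ^ 2 * s / ν)) (x₀ + (R * (lam j / 2)) • yseq j))) atTop
          (𝓝 ((-s) • fderiv ℝ (v₁ s) y)) := by
        rw [← hlimit]
        exact Tendsto.congr hgradZ key
      have key3 := key'.const_smul (-s)⁻¹
      simp only [smul_smul, inv_mul_cancel₀ hns.ne', inv_mul_cancel_left₀ hns.ne', one_smul]
        at key3
      exact key3
    refine ⟨hvel, hgrad, ?_⟩
    -- ## (iii) VORTICITIES: `curl = curlCLM ∘ fderiv`
    have hc := (curlCLM.continuous.tendsto _).comp hgrad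
    have e1 : (fun j => ((R * (lam j / 2)) ^ 2 / ν) • curl (u (T + (R * (lam j / 2)) ^ 2 * s / ν))
        (x₀ + (R * (lam j / 2)) • yseq j)) = fun j => curlCLM (((R * (lam j / 2)) ^ 2 / ν) •
          fderiv ℝ (u (T + (R * (lam j / 2)) ^ 2 * s / ν)) (x₀ + (R * (lam j / 2)) • yseq j)) := by
      funext j; rw [map_smul, ← curl_eq_curlCLM]
    rw [e1, curl_eq_curlCLM]
    exact hc

  -- ## the conclusion: `Uc := v₁`
  have hslab_sub : Ioo (-1 : ℝ) 0 ×ˢ S ⊆ Iio (0 : ℝ) ×ˢ (univ : Set (EuclideanSpace ℝ (Fin 3))) :=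
    prod_mono (fun s hs => hs.2) (subset_univ S)
  refine ⟨M / ν, w, ϖ, H, v₁, hsww, hH, h4top, hapex, hsingw, ?_, hP.2.1.mono hslab_sub, ?_⟩
  · exact ae_restrict_of_ae_restrict_of_subset hslab_sub (by filter_upwards [hae] with z hz using hz.symm)
  -- ## the top-curl fading on the side
  intro x₁ hx₁ θ hθ
  have hx₁0 : x₁ ≠ 0 := fun h => h0S (h ▸ hx₁)
  have hx₁n : 0 < ‖x₁‖ := norm_pos_iff.2 hx₁0
  obtain ⟨ε, hε, hεS⟩ := Metric.isOpen_iff.1 hS x₁ hx₁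
  set r₀ : ℝ := min ε (‖x₁‖ / 2) with hr₀def
  have hr₀ : 0 < r₀ := lt_min hε (by positivity)
  have hr₀x : r₀ ≤ ‖x₁‖ / 2 := min_le_right _ _
  have hxS : ball x₁ r₀ ⊆ S := (ball_subset_ball (min_le_left _ _)).trans hεS
  obtain ⟨J, K', hK'0, hrate⟩ := zoom_top_curl_rate hν hT hsol hρ hM' hR hball1 hlam hlam0 hr₁ hr₁1 hKs hpt
    hSdil hxS hr₀ hr₀x htrace hC1 hS hcurl0
  -- the rate passes to the limit profile
  have hlim_rate : ∀ s ∈ Ioo (-(r₀ / 2) ^ 2) 0, ∀ y ∈ ball x₁ (r₀ / 4), ‖curl (v₁ s) y‖ ≤ K' * (-s) := by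
    intro s hs y hy
    have hc := (hconv s hs.2 y (fun _ => y) tendsto_const_nhds).2.2
    have hev : ∀ᶠ j in atTop, ‖((R * (lam j / 2)) ^ 2 / ν) •
        curl (u (T + (R * (lam j / 2)) ^ 2 * s / ν)) (x₀ + (R * (lam j / 2)) • y)‖ ≤ K' * (-s) := by
      filter_upwards [eventually_ge_atTop J] with j hj
      have h := hrate j hj s hs y hy
      rw [FluidPDE.curl_smul_stPull] at h
      have e1 : R * (lam j / 2) / ν * (R * (lam j / 2)) = (R * (lam j / 2)) ^ 2 / ν := by ring
      have e2 : T + (R * (lam j / 2)) ^ 2 / ν * s = T + (R * (lam j / 2)) ^ 2 * s / ν := by ring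
      rwa [e1, e2] at h
    exact le_of_tendsto hc.norm hev
  -- thresholds
  set s₀ : ℝ := max (-(r₀ / 2) ^ 2) (max (-1) (-(θ / (K' + 1)))) with hs₀def
  have hq : 0 < (r₀ / 2) ^ 2 := by positivity
  have hθK : 0 < θ / (K' + 1) := by positivity
  refine ⟨s₀, r₀ / 4, ?_, ?_, by positivity, fun s hs y hy => ?_⟩
  · simp only [hs₀def, max_lt_iff]; exact ⟨by linarith, by norm_num, by linarith⟩
  · simp only [hs₀def]; exact le_trans (le_max_left _ _) (le_max_right _ _)
  have hs1 : -(r₀ / 2) ^ 2 < s := lt_of_le_of_lt (le_max_left _ _) hs.1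
  have hs2 : -(θ / (K' + 1)) < s := lt_of_le_of_lt ((le_max_right _ _).trans (le_max_right _ _)) hs.1
  calc ‖curl (v₁ s) y‖ ≤ K' * (-s) := hlim_rate s ⟨hs1, hs.2⟩ y hy
    _ ≤ K' * (θ / (K' + 1)) := mul_le_mul_of_nonneg_left (by linarith) hK'0
    _ ≤ θ := by
        rw [mul_div_assoc']
        rw [div_le_iff₀ (by positivity)]
        nlinarith


end Summit.NavierStokesRegularity.NavierStokesRegularity.Theorems.LocalIrrotationalScarDoorLocalPointZoomScarCurlRep

end
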